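import Summits.ResolutionOfSingularities.ResolutionOfSingularities.Theorems.PurelyInseparableDim4PermissibleLocus
import HarnessLib

/-!
# [OURS · res-dim4-pi] IN COORDINATE SCOPE the components of the `p`-fold locus through the point are EXACTLY
  the inclusion-minimal Hironaka-permissible coordinate centres, and MODE 1h blows up a component of maximal
  dimension

Cell `res-dim4-pi` (D-0157 DOOR 2, wave 2), seat `res-dim4-p-6`; sequel of `PurelyInseparableDim4PermissibleLocus`
(`isPermissibleCentre_iff_singLocusIdeal_le`: for clean `F`, `q = p`, condition (1) ⟺ `J_p⁺(F) ≤ (x_S)`).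
Frame v4 (`PurelyInseparableDim4Scope`, WORD #20 (c)) calls a state IN COORDINATE SCOPE when every minimal prime
of `J_p⁺(F)` inside `𝔪₀` is a coordinate ideal `(x_S)`; out of scope the frame is blind (TRAP-1, T-002,
the uniform trap: the largest coordinate subspace inside a NON-coordinate component is permissible but is not
the component).  THIS FILE, for clean `F` at `q = p`:

* `span_X_le_span_X_iff` (bookkeeping: `(x_S) ≤ (x_T) ↔ S ⊆ T`);
* **`minimal_isPermissibleCentre_of_mem_minimalPrimes`** — a coordinate minimal prime `(x_S)` of `J_p⁺(F)` is
  an inclusion-MINIMAL permissible centre (no scope hypothesis: smaller permissible `T ⊊ S` would give a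
  smaller prime `(x_T) ⊇ J_p⁺`);
* **`span_X_mem_minimalPrimes_of_minimal`** — IN SCOPE, conversely, an inclusion-minimal permissible `S` spans a
  minimal prime `(x_S)` of `J_p⁺(F)` (the minimal prime below `(x_S)` is coordinate by scope, permissible by
  `PermissibleLocus`, hence equal);
* **`span_X_mem_minimalPrimes_of_isMode1hCentre`** — IN SCOPE, every MODE-1h centre (least cardinality among
  permissible) spans a minimal prime: MODE 1h = «blow up a component of the `p`-fold locus of maximal dimension»,
  the classical choice, exactly on in-scope states; `exists_component_of_inCoordinateScope` (a permissible
  centre which is a component always exists in scope when the origin is `p`-fold).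

[OURS · counted 0 · elementary · AI kernel work, weaker than expert review.]  A dictionary about OUR frame;
NOTHING here is a statement about resolution of singularities; resolution in dimension `≥ 4` /
characteristic `p > 0` is NOT proved by anything in this file.
bears_on: LADDER-RESOLUTION:D157-DOOR2 (res-dim4-pi · frame v4 dictionary).  Host item (DR-157-C): `stmt-ResolutionOfSingularities-16155`.
-/

noncomputable section

set_option linter.dupNamespace false -- mandated namespace of this single-conjunct summit

open MvPolynomial Finset

namespace Summit.ResolutionOfSingularities.ResolutionOfSingularities.Theorems.PIDim4

namespace PermissibleLocus

open Literature.AlgebraicGeometry.Resolution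
open Literature.AlgebraicGeometry.Resolution.CentreBlowup
open Literature.AlgebraicGeometry.Resolution.Hauser2010
open Literature.RingTheory.MvPolynomial

variable {K : Type} [Field K]

/-- `(x_S) ≤ (x_T) ↔ S ⊆ T` for coordinate sets of the four variables. [folklore] -/
theorem span_X_le_span_X_iff (S T : Finset (Fin 4)) :
    Ideal.span ((fun i => (X i : MvPolynomial (Fin 4) K)) '' (S : Set (Fin 4))) ≤
        Ideal.span ((fun i => (X i : MvPolynomial (Fin 4) K)) '' (T : Set (Fin 4))) ↔ S ⊆ T := by
  rw [show ((fun i => (X i : MvPolynomial (Fin 4) K)) '' (S : Set (Fin 4))) = X '' (S : Set (Fin 4)) from rfl,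
    show ((fun i => (X i : MvPolynomial (Fin 4) K)) '' (T : Set (Fin 4))) = X '' (T : Set (Fin 4)) from rfl,
    span_X_image_le_iff, Finset.coe_subset]

/-- **A coordinate component is an inclusion-minimal permissible centre** (clean `F`, `q = p`; no scope
hypothesis): if `(x_S)` is a minimal prime of `J_p⁺(F)` then `S` is permissible and no proper subset of `S` is.
[folklore] -/
theorem minimal_isPermissibleCentre_of_mem_minimalPrimes (p : ℕ) [Fact p.Prime] [CharP K p]
    {F : MvPolynomial (Fin 4) K} (hclean : deletePthPowers p F = F) (hF : F ≠ 0) {S : Finset (Fin 4)}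
    (hS : Ideal.span ((fun i => (X i : MvPolynomial (Fin 4) K)) '' (S : Set (Fin 4))) ∈
      (singLocusIdeal p F).minimalPrimes) :
    IsPermissibleCentre p S F ∧ ∀ T : Finset (Fin 4), T ⊂ S → ¬ IsPermissibleCentre p T F := by
  have hJS : singLocusIdeal p F ≤ _ := hS.1.2
  have hSne : S.Nonempty := by
    rw [Finset.nonempty_iff_ne_empty]
    rintro rfl
    apply singLocusIdeal_ne_bot p hclean hF
    rw [eq_bot_iff]
    refine hJS.trans (le_of_eq ?_)
    rw [Finset.coe_empty, Set.image_empty, Ideal.span_empty]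
  refine ⟨(isPermissibleCentre_iff_singLocusIdeal_le p hclean).mpr ⟨hSne, hJS⟩, fun T hTS hT => ?_⟩
  have hJT := ((isPermissibleCentre_iff_singLocusIdeal_le p hclean).mp hT).2
  haveI : (Ideal.span ((fun i => (X i : MvPolynomial (Fin 4) K)) '' (T : Set (Fin 4)))).IsPrime :=
    isPrime_span_X_image (T : Set (Fin 4))
  have hle : Ideal.span ((fun i => (X i : MvPolynomial (Fin 4) K)) '' (T : Set (Fin 4))) ≤
      Ideal.span ((fun i => (X i : MvPolynomial (Fin 4) K)) '' (S : Set (Fin 4))) :=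
    (span_X_le_span_X_iff T S).mpr hTS.subset
  have hge := hS.2 ⟨this, hJT⟩ hle
  exact hTS.not_subset ((span_X_le_span_X_iff S T).mp hge)

/-- **In scope, an inclusion-minimal permissible centre IS a component**: for a clean `F` in coordinate scope,
if `S` is permissible and no proper subset is, then `(x_S)` is a minimal prime of `J_p⁺(F)`. [folklore] -/
theorem span_X_mem_minimalPrimes_of_minimal (p : ℕ) [Fact p.Prime] [CharP K p]
    {F : MvPolynomial (Fin 4) K} (hclean : deletePthPowers p F = F) (hF : F ≠ 0)
    (hscope : InCoordinateScope p F) {S : Finset (Fin 4)} (hS : IsPermissibleCentre p S F)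
    (hmin : ∀ T : Finset (Fin 4), T ⊂ S → ¬ IsPermissibleCentre p T F) :
    Ideal.span ((fun i => (X i : MvPolynomial (Fin 4) K)) '' (S : Set (Fin 4))) ∈
      (singLocusIdeal p F).minimalPrimes := by
  haveI hprime : (Ideal.span ((fun i => (X i : MvPolynomial (Fin 4) K)) '' (S : Set (Fin 4)))).IsPrime :=
    isPrime_span_X_image (S : Set (Fin 4))
  have hJS := ((isPermissibleCentre_iff_singLocusIdeal_le p hclean).mp hS).2
  obtain ⟨P, hPmin, hPS⟩ := Ideal.exists_minimalPrimes_le hJS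
  -- `P` is coordinate (scope) and permissible (PermissibleLocus), hence `P = (x_S)` by minimality of `S`
  have hP0 : P ≤ originIdeal K := hPS.trans (IsolatedScope.span_X_image_le_originIdeal _)
  obtain ⟨T, rfl⟩ := hscope P hPmin hP0
  have hTS : T ⊆ S := (span_X_le_span_X_iff T S).mp hPS
  have hT : IsPermissibleCentre p T F := by
    refine (isPermissibleCentre_iff_singLocusIdeal_le p hclean).mpr ⟨?_, hPmin.1.2⟩
    rw [Finset.nonempty_iff_ne_empty]
    rintro rfl
    -- `(x_∅) = ⊥` would contain `J_p⁺(F) ≠ 0`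
    apply singLocusIdeal_ne_bot p hclean hF
    rw [eq_bot_iff]
    refine hPmin.1.2.trans (le_of_eq ?_)
    rw [Finset.coe_empty, Set.image_empty, Ideal.span_empty]
  have hTeq : T = S := by
    by_contra hne
    exact hmin T (Finset.ssubset_iff_subset_ne.mpr ⟨hTS, hne⟩) hT
  subst hTeq
  exact hPmin

/-- A least-cardinality permissible centre is inclusion-minimal. [folklore] -/
theorem minimal_of_isMode1hCentre {q : ℕ} {F : MvPolynomial (Fin 4) K} {S : Finset (Fin 4)}
    (h : IsMode1hCentre q S F) : ∀ T : Finset (Fin 4), T ⊂ S → ¬ IsPermissibleCentre q T F :=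
  fun T hTS hT => absurd (h.2 T hT) (not_le.mpr (Finset.card_lt_card hTS))

/-- **IN SCOPE, MODE 1h BLOWS UP A COMPONENT OF THE `p`-FOLD LOCUS OF MAXIMAL DIMENSION**: for a clean `F` in
coordinate scope, every MODE-1h centre `S` (least cardinality among the Hironaka-permissible coordinate centres)
spans a minimal prime `(x_S)` of `J_p⁺(F)`, and no component through the point has smaller codimension
(every coordinate component `(x_T)` through the point has `|S| ≤ |T|`). [folklore] -/
theorem span_X_mem_minimalPrimes_of_isMode1hCentre (p : ℕ) [Fact p.Prime] [CharP K p]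
    {F : MvPolynomial (Fin 4) K} (hclean : deletePthPowers p F = F) (hF : F ≠ 0)
    (hscope : InCoordinateScope p F) {S : Finset (Fin 4)} (hS : IsMode1hCentre p S F) :
    Ideal.span ((fun i => (X i : MvPolynomial (Fin 4) K)) '' (S : Set (Fin 4))) ∈
        (singLocusIdeal p F).minimalPrimes ∧
      ∀ T : Finset (Fin 4), Ideal.span ((fun i => (X i : MvPolynomial (Fin 4) K)) '' (T : Set (Fin 4))) ∈
        (singLocusIdeal p F).minimalPrimes → S.card ≤ T.card :=
  ⟨span_X_mem_minimalPrimes_of_minimal p hclean hF hscope hS.1 (minimal_of_isMode1hCentre hS),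
    fun _ hT => hS.2 _ (minimal_isPermissibleCentre_of_mem_minimalPrimes p hclean hF hT).1⟩

/-- **In scope a component is always available**: for a clean non-zero `F` in coordinate scope with `p`-fold
origin (`p ≤ ord₀ F`), some Hironaka-permissible coordinate centre spans a minimal prime of `J_p⁺(F)`.
[folklore] -/
theorem exists_component_of_inCoordinateScope (p : ℕ) [Fact p.Prime] [CharP K p]
    {F : MvPolynomial (Fin 4) K} (hclean : deletePthPowers p F = F) (hF : F ≠ 0)
    (hscope : InCoordinateScope p F) (h0 : (p : ℕ∞) ≤ ordAlong Finset.univ F) :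
    ∃ S : Finset (Fin 4), IsPermissibleCentre p S F ∧
      Ideal.span ((fun i => (X i : MvPolynomial (Fin 4) K)) '' (S : Set (Fin 4))) ∈
        (singLocusIdeal p F).minimalPrimes := by
  haveI : (originIdeal K).IsPrime := by
    show (RingHom.ker (MvPolynomial.eval (0 : Fin 4 → K))).IsPrime
    exact RingHom.ker_isPrime _
  obtain ⟨P, hPmin, hP0⟩ :=
    Ideal.exists_minimalPrimes_le (IsolatedScope.singLocusIdeal_le_originIdeal_of_le_ordAlong_univ h0)
  obtain ⟨S, hS, hperm⟩ := isPermissibleCentre_of_mem_minimalPrimes p hclean hF hscope hPmin hP0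
  exact ⟨S, hperm, hS ▸ hPmin⟩

end PermissibleLocus

end Summit.ResolutionOfSingularities.ResolutionOfSingularities.Theorems.PIDim4

end
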